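import Literature.AnabelianGeometry.SemiGraphs.GaloisLevelDataOfOpenNormal
import Literature.AnabelianGeometry.SemiGraphs.GaloisLevelDataChart
import Literature.AnabelianGeometry.SemiGraphs.TemperedPiLevelKernelStabilizer
import Literature.AnabelianGeometry.SemiGraphs.ChartFibreProfiniteCompletionTransport
import Literature.AnabelianGeometry.SemiGraphs.ProfiniteCompletionIndexFinite
import Literature.AnabelianGeometry.SemiGraphs.TemperedVerticialNamedFactsProofs
import Literature.AnabelianGeometry.SemiGraphs.TemperedPiLevelsConnected
import HarnessLib

/-!
# The finite levels of a PRESCRIBED Galois tower are characteristic open cores of ITS tempered group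
# ([SemiAnbd] Prop 3.6 (iii) p. 38, Prop 5.2 (i) p. 63) — E1 junction (J2d): the capstone binder `hker`

Mochizuki, *Semi-graphs of anabelioids*, Publ. RIMS **42** (2006), §3 Prop 3.6 (iii) p. 38 ("`π₁^temp(G) ↪
π̂₁(G)` … `π̂₁(G)` is the profinite completion"), §5 Prop 5.2 (i) p. 63 [cite: MochizukiSemiAnbd2006, Prop 3.6(iii) p.38];
Dixon–du Sautoy–Mann–Segal, *Analytic pro-p groups*, Prop. 1.6 [cite: DixonEtAl1999, Prop 1.6].

PROOF-ONLY file (no definitions; seat abc-iut-L3-t9, E1 junction of the abc-iut cell's row T54-B =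
`plan/GAP-LEDGER.md` G-w4d053-1, sub-row (J2d)).  Let `D := GaloisLevelData.ofGaloisSeq 𝒢 hc v₀ A hA f` be
the Galois tower over a PRESCRIBED sequence of Galois objects `A k` of `B(𝒢)` (abc-iut-L3-t9,
`GaloisLevelDataOfSeq.lean`; e.g. `GaloisLevelData.ofOpenNormalSeq` at characteristic open cores), cofinal
(`hcof`), with its OWN Prop 3.6 chart `c' := D.chart …` (`GaloisLevelDataChart.lean`; `c'.G = D.temperedPi`).
If every point of the `v₀`-fibre `F(A k)` (`F := 𝒢.fiberAt v₀`, the Galois-category basepoint; `Aut F =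
π̂₁`) has `Aut F`-stabiliser the characteristic open core `charOpenCore (Aut F) d` (this is how
`ofOpenNormalSeq` builds its levels: `stabilizer_eq_of_openNormalObj`), THEN

  **`ker_piLevelAut_eq_charOpenCore` : `ker π_k = charOpenCore (D.temperedPi) d`**

— the finite level `ker π_k` of the NEW tempered group is a CHARACTERISTIC OPEN CORE of that group, hence
fixed by every bi-continuous automorphism: the hypothesis `hker` of abc-iut-L3-t9's
`hLst_of_ker_piLevelAut_eq_charOpenCore` / `hKst_and_hLst_of_ker_piLevelAut_eq_charOpenCore`
(`ArithTowerLevelStabilityJunction.lean`, p432096), so BOTH Φ-stability binders `hKst`/`hLst` of the T54-B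
capstone HOLD at the characteristic tower, for every outer action.  Proof: `ker π_k` is the
`π₁^temp`-stabiliser of the base point `x_k` (`mem_ker_piLevelAut_iff_piAct_x`,
`TemperedPiLevelKernelStabilizer.lean`); through the chart's profinite-completion map
`ι : π₁^temp → Aut F` at `v₀` (abc-iut-L3-t7/w4-d012's `isProfiniteCompletion_conjAut_chartActionFin`,
transported along the natural isomorphism `j : chartFibre c' ≅ F`, under which `γ` acts on `F(A k)` as
`piAct γ` conjugated by `j`) that stabiliser is `ι⁻¹(Stab_{Aut F}(j x_k)) = ι⁻¹(charOpenCore (Aut F) d)`,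
and `ι⁻¹` carries characteristic open cores to characteristic open cores
(`IsProfiniteCompletion.comap_charOpenCore`).  Nothing here takes a side on [IUTchIII] Cor. 3.12; typed ≠ proved.
-/

namespace Literature.AnabelianGeometry.SemiGraphs

namespace ProfiniteSemiGraph

open CategoryTheory CategoryTheory.PreGaloisCategory Literature.AnabelianGeometry.Anabelioids
open scoped FintypeCatDiscrete

universe u

variable (𝒢 : ProfiniteSemiGraph.{u}) (h36 : 𝒢.Prop36Hypotheses) (v₀ : 𝒢.graph.Vertex)
  (A : ℕ → 𝒢.toAnab.BObj)
  (hA : ∀ n, letI := SemiGraphOfAnabelioids.galoisCategory_bObj 𝒢.toAnab ⟨h36.isConnected⟩; IsGalois (A n))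
  (f : ∀ n, A (n + 1) ⟶ A n)
  (hcof : ∀ (T : CovObj 𝒢), T.IsTempered → ∀ p : T.Point, ∃ i : ℕ, ∀ j, i ≤ j →
    ((GaloisLevelData.ofGaloisSeq 𝒢 h36.isConnected v₀ A hA f).S j).Splits (T.component p))

/-- The levels `ofBObj (A n)` of the prescribed tower are connected coverings (the input `hconn` of
`piLevelAut`). [cite: MochizukiSemiAnbd2006, Prop 3.6(i) p.38] -/
theorem ofGaloisSeq_hconn (n : ℕ) (p q : ((GaloisLevelData.ofGaloisSeq 𝒢 h36.isConnected v₀ A hA f).S n).Point) :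
    ((GaloisLevelData.ofGaloisSeq 𝒢 h36.isConnected v₀ A hA f).S n).SameComponent p q :=
  letI := SemiGraphOfAnabelioids.galoisCategory_bObj 𝒢.toAnab ⟨h36.isConnected⟩
  sameComponent_ofBObj_of_isConnected h36.isConnected (A n) (hA n).toIsConnected p q

include hcof in
/-- **The finite level `ker π_k` of a prescribed tower is the characteristic open core of ITS tempered
group** whenever the `π̂₁`-stabilisers of the points of `F(A k)` are the characteristic open core
`charOpenCore (Aut F) d` (`F := 𝒢.fiberAt v₀`): `ker π_k = charOpenCore (D.temperedPi) d`.
[cite: MochizukiSemiAnbd2006, Prop 3.6(iii) p.38] -/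
theorem ker_piLevelAut_ofGaloisSeq_eq_charOpenCore (k d : ℕ)
    (hstab : ∀ x : (𝒢.fiberAt v₀).obj (A k),
      MulAction.stabilizer (Aut (𝒢.fiberAt v₀)) x = charOpenCore (Aut (𝒢.fiberAt v₀)) d) :
    ((GaloisLevelData.ofGaloisSeq 𝒢 h36.isConnected v₀ A hA f).piLevelAut h36.isCountable
        (𝒢.ofGaloisSeq_hconn h36 v₀ A hA f) k).ker =
      charOpenCore ((GaloisLevelData.ofGaloisSeq 𝒢 h36.isConnected v₀ A hA f).temperedPi h36.isCountable) d := by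
  -- notation
  let D := GaloisLevelData.ofGaloisSeq 𝒢 h36.isConnected v₀ A hA f
  have hS : ∀ n, (D.S n).Splits (D.S n) := GaloisLevelData.ofGaloisSeq_splits_self 𝒢 h36.isConnected v₀ A hA f
  have hfinS : ∀ n, (D.S n).IsFinite := GaloisLevelData.ofGaloisSeq_isFinite 𝒢 h36.isConnected v₀ A hA f
  have hneS : ∀ n, (D.S n).HasNonemptyFibres :=
    GaloisLevelData.ofGaloisSeq_hasNonemptyFibres 𝒢 h36.isConnected v₀ A hA f
  -- the chart of the tower `D`
  let c' : TemperedPiChart 𝒢 := D.chart h36.isCountable hcof h36.isConnected hS hfinS hneS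
  -- finite objects are tempered; the chart fibre functor has finite values (it IS `X ↦ X_{v₀}`)
  have h𝒢' : ∀ S : CovObj 𝒢, S.IsFinite → S.IsTempered := isTempered_of_isFinite_of_prop36 h36
  have hfin' : ∀ X : 𝒢.toAnab.BObj, Finite ((chartFibre c' h𝒢').obj X) := fun X =>
    show Finite ((𝒢.fiberAt v₀).obj X) from inferInstance
  -- the profinite-completion map `ι : π₁^temp → Aut F` at `v₀`
  obtain ⟨dat⟩ := nonempty_chartVertexDatum h36 c'
  obtain ⟨ψ, ⟨e⟩⟩ := exists_isVerticialHom h36.isQuasiCoherent h36.isGaloisCountable c' v₀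
  have hι := isProfiniteCompletion_conjAut_chartActionFin c' h𝒢' hfin' dat v₀ ψ e
  set j := chartFibreFinIsoρ c' h𝒢' hfin' v₀ ψ e with hj
  -- the base point `x_k` of the `k`-th level and its image under `j`
  let xk : (𝒢.fiberAt v₀).obj (A k) := D.x k
  let lev : ((D.S k).SV D.v₀).obj.V → ℕ := D.levelOf hcof ((𝒢.ofBObjTemp h𝒢').obj (A k))
  have hlev : ∀ (s : ((D.S k).SV D.v₀).obj.V) (n : ℕ), lev s ≤ n →
      (D.S n).Splits ((D.S k).component (Sum.inl ⟨D.v₀, s⟩)) :=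
    D.levelOf_spec hcof ((𝒢.ofBObjTemp h𝒢').obj (A k))
  -- (1) the transported action of `γ` on `j x` is `j (γ · x)`
  have hact : ∀ (γ : D.temperedPi h36.isCountable) (x : (𝒢.fiberAt v₀).obj (A k)),
      (j.conjAut (chartActionFin c' h𝒢' hfin' γ)).hom.app (A k) (j.hom.app (A k) x) =
        j.hom.app (A k) (D.piAct h36.isCountable (D.S k) lev hlev γ x) := by
    intro γ x
    rw [conjAut_chartActionFin_hom_app_apply, Iso.hom_inv_id_app_apply, chartActionFin_hom_app_apply_eq]
    rfl
  have hjinj : Function.Injective (j.hom.app (A k)) := fun a b hab => by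
    have := congrArg (j.inv.app (A k)) hab
    rwa [Iso.hom_inv_id_app_apply, Iso.hom_inv_id_app_apply] at this
  -- (2) assemble
  ext γ
  rw [GaloisLevelData.mem_ker_piLevelAut_iff_piAct_x D h36.isCountable (𝒢.ofGaloisSeq_hconn h36 v₀ A hA f)
      hS k lev hlev γ]
  change _ ↔ γ ∈ charOpenCore c'.G d
  rw [← IsProfiniteCompletion.comap_charOpenCore hι d]
  refine Iff.trans ?_ Subgroup.mem_comap.symm
  change _ ↔ j.conjAut (chartActionFin c' h𝒢' hfin' γ) ∈ charOpenCore _ d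
  rw [← hstab (j.hom.app (A k) xk), MulAction.mem_stabilizer_iff]
  change D.piAct h36.isCountable (D.S k) lev hlev γ xk = xk ↔
    (j.conjAut (chartActionFin c' h𝒢' hfin' γ)).hom.app (A k) (j.hom.app (A k) xk) = j.hom.app (A k) xk
  rw [hact]
  exact ⟨fun h => by rw [h], fun h => hjinj h⟩

/-! ### At the characteristic tower `GaloisLevelData.ofOpenNormalSeq` -/

/-- **E1 junction (J2d) at the characteristic tower**: for the tower `GaloisLevelData.ofOpenNormalSeq` built
from open normal subgroups `V k` of `Aut(𝒢.fiberAt v₀)` which ARE characteristic open cores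
(`V k = charOpenCore _ (d k)`, abc-iut-w4-d053/w4-d048), every finite level satisfies
`ker π_k = charOpenCore (π₁^temp of the tower) (d k)` — the hypothesis `hker` of
`hKst_and_hLst_of_ker_piLevelAut_eq_charOpenCore` (p432096): BOTH capstone binders `hKst`/`hLst` hold at
this tower, for every outer action. [cite: MochizukiSemiAnbd2006, Prop 5.2 (i), p. 63] -/
theorem ker_piLevelAut_ofOpenNormalSeq_eq_charOpenCore
    (V : ℕ → OpenSubgroup (Aut (𝒢.fiberAt v₀))) (hVn : ∀ k, (V k).toSubgroup.Normal)
    (hanti : ∀ k, (V (k + 1)).toSubgroup ≤ (V k).toSubgroup)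
    (hcofV : ∀ (T : CovObj 𝒢), T.IsTempered → ∀ p : T.Point, ∃ i : ℕ, ∀ j, i ≤ j →
      ((GaloisLevelData.ofOpenNormalSeq 𝒢 h36.isConnected v₀ V hVn hanti).S j).Splits (T.component p))
    (d : ℕ → ℕ) (hV : ∀ k, (V k).toSubgroup = charOpenCore (Aut (𝒢.fiberAt v₀)) (d k)) (k : ℕ) :
    ((GaloisLevelData.ofOpenNormalSeq 𝒢 h36.isConnected v₀ V hVn hanti).piLevelAut h36.isCountable
        (GaloisLevelData.ofOpenNormalSeq_hconn 𝒢 h36.isConnected v₀ V hVn hanti) k).ker =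
      charOpenCore ((GaloisLevelData.ofOpenNormalSeq 𝒢 h36.isConnected v₀ V hVn hanti).temperedPi
        h36.isCountable) (d k) :=
  𝒢.ker_piLevelAut_ofGaloisSeq_eq_charOpenCore h36 v₀ _ _ _ hcofV k (d k) fun x => by
    rw [← hV k]
    exact 𝒢.stabilizer_eq_of_openNormalObj h36.isConnected v₀ V hVn k x

end ProfiniteSemiGraph

end Literature.AnabelianGeometry.SemiGraphs
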